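import Mathlib.Analysis.SpecialFunctions.Log.Base
import Literature.Computability.QuantumComplexity.StabilizerRank
import Literature.Computability.Cryptography.QuantumCircuit
import Literature.Computability.Cryptography.TCount
import HarnessLib

/-!
# Approximate stabilizer rank under `T`-gadgets, ancilla removal and for Haar-typical states (Mehraban–Tahmasbi 2024)

Named facts (D-0014) from S. Mehraban, M. Tahmasbi, *Quadratic lower bounds on the approximate
stabilizer rank: a probabilistic approach*, STOC 2024 = arXiv:2305.10277, §3 (read at the
source, arXiv v. pp. 12–15), over the tree's `approxStabilizerRank` / `stabilizerRank` /
`magicT` / `tensorPow` (`StabilizerRank.lean`) and oracle-free Clifford+`T` circuits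
`QCircuit cliffordT N` with their `T`-count (`QuantumCircuit.lean`, `TCount.lean`). Requested by
route `FermionicMagic` of `QuantumAdvantage` (items `FermionicMagic.ApproxGadgetTransfer`,
`FermionicMagic.AncillaDrop`), which transfer approximate-rank lower bounds from cheaply
preparable target states to `|T⟩^{⊗t}`; the EXACT-rank analogue is the tree fact
`BravyiGosset2016_stabilizerRank_output_le` (`StabilizerSimulation.lean`, not imported here so that
the import cone of these facts contains no other unproved fact).

* `MehrabanTahmasbi2024_approxRank_output_le` — **Lemma 3.6**: for a circuit `V` of Clifford
  gates and `k` `T` gates, `χ_δ(V|0⟩) ≤ χ_δ(|T⟩^{⊗k})` (same `δ`; proof by `T`-gadget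
  teleportation with uniform outcomes, Lemma 3.7, and the balanced-measurement Lemma 3.8).
* `MehrabanTahmasbi2024_approxRank_le_tensor_zeroState` — **§3.4, step (a)**: `χ_δ(φ) ≤
  χ_δ(φ ⊗ |0^λ⟩)` ("`I ⊗ |0^λ⟩⟨0^λ|` maps stabilizer states to scalar multiples of stabilizer
  states or `0`").
* `MehrabanTahmasbi2024_exists_large_approxRank` — **Lemma 3.2** (consequence): there is an
  absolute `C > 0` (`C = 1/1000` in print) such that for `0 < δ < 1` and `n ≥ 2·log₂(1/(1−δ²)) + 9` some unit `n`-qubit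
  state has `χ_δ ≥ C (1−δ²)² 2ⁿ/n²` (Haar-random states, counting stabilizer states `≤ 2^{0.54 n²}`
  per term).

## Design choices

* Circuits are the tree's `QCircuit cliffordT N` restricted to `IsOracleFree` (the printed
  circuits have no oracle gates; the oracle argument `A` of `toMatrix` is then irrelevant and is
  universally quantified), `k = U.tCount`, input `|0^N⟩ = zeroState N`.
* `δ : ℝ` is unrestricted in the first two facts, as in print (the definition uses `δ²`).
* In Lemma 3.2 the logarithm is BASE 2 (`Real.logb 2`): the printed threshold `n ≥ 2 log(1/(1−δ²)) + 9`
  closes the printed proof (exponent `≤ −0.0026 (1−δ²)² 2ⁿ < −1`) only for `log = log₂` (`2⁹ = 512 ≥ 385`);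
  "state" means unit vector, `normSq φ = 1`; the printed constant is `C = 1/1000` (we keep `∃ C ≥ 1/1000`).

## Deliberately not here

Lemma 3.8 itself (needs post-measurement states), Theorem 1.1/3.9 (`χ_δ(|T⟩^{⊗m}) = Ω̃(m²)`, whose
proof also uses the Low–Kliuchnikov–Schaeffer state-preparation count, Lemma 3.5), the conditional
Theorem 1.6 (exact rank of `|T⟩^{⊗m}` superpolynomial unless the permanent has polynomial-size
circuits) and Cor. 3.10.
-/

noncomputable section

open Matrix

namespace Literature.Computability.QuantumComplexity

/-- **Mehraban–Tahmasbi 2024, Lemma 3.6** ("Let `V` be a quantum circuit consisting of Clifford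
gates and `k` `T` gates. Then `χ_δ(V|0⟩) ≤ χ_δ(|T⟩^{⊗k})`"): for every oracle-free Clifford+`T`
circuit `U` on `N` wires and every `δ`, the `δ`-approximate stabilizer rank of `U|0^N⟩` is at
most that of `|T⟩^{⊗ tCount U}`. Proof in print: replace each `T` by the Gottesman–Chuang
state-injection gadget consuming one `|T⟩`; the measurement outcomes are uniform (Lemma 3.7), a
balanced single-qubit measurement does not increase `χ_δ` for at least one outcome (Lemma 3.8),
Clifford unitaries preserve `χ_δ`, and `χ_δ(|0^N⟩ ⊗ |T⟩^{⊗k}) = χ_δ(|T⟩^{⊗k})`. Grounds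
`Summit.QuantumAdvantage.QuantumAdvantage.Theses.FermionicMagic.ApproxGadgetTransfer` (same
statement). [cite: MehrabanTahmasbi2024, Lemma 3.6] -/
def MehrabanTahmasbi2024_approxRank_output_le : Prop :=
  ∀ {N : ℕ} (U : Cryptography.QCircuit Cryptography.cliffordT N) (_hU : U.IsOracleFree)
    (A : Language Bool) (δ : ℝ),
    approxStabilizerRank δ (U.toMatrix A *ᵥ Cryptography.zeroState N) ≤
      approxStabilizerRank δ (tensorPow magicT U.tCount)

/-- **Mehraban–Tahmasbi 2024, §3.4 step (a)** (removing clean ancillas does not lower the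
approximate rank): `χ_δ(φ) ≤ χ_δ(φ ⊗ |0^λ⟩)` for every `n`-qubit vector `φ`, every `λ` and every
`δ` — "since `I ⊗ |0^λ⟩⟨0^λ|` maps stabilizer states to scalar multiples of stabilizer states or
`0`, any approximate decomposition of `φ ⊗ |0^λ⟩` into stabilizer states yields a decomposition of
`φ` with the same number of terms and approximation parameter". Grounds
`Summit.QuantumAdvantage.QuantumAdvantage.Theses.FermionicMagic.AncillaDrop` (same statement). [cite: MehrabanTahmasbi2024, §3.4 (a)] -/
def MehrabanTahmasbi2024_approxRank_le_tensor_zeroState : Prop :=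
  ∀ {n : ℕ} (m : ℕ) (ψ : Cryptography.QReg n → ℂ) (δ : ℝ),
    approxStabilizerRank δ ψ ≤
      approxStabilizerRank δ (Cryptography.tensorVec ψ (Cryptography.zeroState m))

/-- **Mehraban–Tahmasbi 2024, Lemma 3.2** (Haar-typical states have large approximate stabilizer
rank; second display): there is an absolute constant `C > 0` (the proof gives `C = 1/1000`) such that for
`0 < δ < 1` and `n ≥ 2 log₂(1/(1−δ²)) + 9` there exists an `n`-qubit state `φ` with
`χ_δ(φ) ≥ C (1 − δ²)² 2ⁿ / n²` (logarithm base 2: the only reading under which the printed `+9` closes the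
proof, `2⁹ = 512 ≥ 385/(1−δ²)²·(1−δ²)²`). (First display: for Haar-random `φ`, `n ≥ 6` and
`1 − δ² − M/2ⁿ > 0`, `Pr[χ_δ(φ) ≤ M] ≤ 2 exp(0.54 n² M − (1 − δ² − M/2ⁿ)² 2ⁿ/(100π))`.) This is
the TARGET step of the quadratic lower bound `χ_δ(|T⟩^{⊗m}) = Ω̃(m²)`; route `FermionicMagic`
proposes explicit free-fermion states in place of `φ`. [cite: MehrabanTahmasbi2024, Lemma 3.2] -/
def MehrabanTahmasbi2024_exists_large_approxRank : Prop :=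
  ∃ C : ℝ, 1 / 1000 ≤ C ∧ ∀ (δ : ℝ), 0 < δ → δ < 1 → ∀ n : ℕ,
    2 * Real.logb 2 (1 / (1 - δ ^ 2)) + 9 ≤ (n : ℝ) →
      ∃ φ : Cryptography.QReg n → ℂ, Cryptography.normSq φ = 1 ∧
        C * (1 - δ ^ 2) ^ 2 * (2 : ℝ) ^ n / (n : ℝ) ^ 2 ≤ (approxStabilizerRank δ φ : ℝ)

end Literature.Computability.QuantumComplexity
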